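import Summits.Ventures.QEC.Census.CertBZPlane
import Summits.Ventures.QEC.Census.TwoBGA.S8_4x24_w6_k12_0001111.Cert
import HarnessLib

/-!
# `S8_4x24_w6_k12_0001111` — lane-engine replays, part 4/5 (census row `S8_4x24_w6_k12_0001111`; qec-search-4 orbit lane, emitted by qec-type-08 g7)

`Plane.segOK` verdicts (type-01 lane engine, `decide +kernel`) for segments of the kernel-basis replays of the views of
`Census/TwoBGA/S8_4x24_w6_k12_0001111/`; assembled in `Distance.lean`.  Generated by `tools/gen4/emit_orbit_row.py`; do not edit by hand.
-/

set_option autoImplicit false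
set_option Elab.async false

namespace Summit.Ventures.QEC.Census.S8_4x24_w6_k12_0001111

open Summit.Ventures.QEC.Census

set_option maxHeartbeats 400000000 in
/-- `X` view 0, lane segment `[75, 79)` (5577040 lanes, depth 5, threshold 11; est 33 s): every selection with largest row there passes (lane engine, KERNEL). -/
theorem psegX_0_3 : Plane.segOK 192 11 (S8_4x24_w6_k12_0001111.cert.sideX.found.map Prod.fst) S8_4x24_w6_k12_0001111.pGX_0 5 75 4 51 = true := by
  decide +kernel

set_option maxHeartbeats 400000000 in
/-- `X` view 0, lane segment `[79, 82)` (5004104 lanes, depth 5, threshold 11; est 29 s): every selection with largest row there passes (lane engine, KERNEL). -/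
theorem psegX_0_4 : Plane.segOK 192 11 (S8_4x24_w6_k12_0001111.cert.sideX.found.map Prod.fst) S8_4x24_w6_k12_0001111.pGX_0 5 79 3 51 = true := by
  decide +kernel

set_option maxHeartbeats 400000000 in
/-- `X` view 0, lane segment `[82, 85)` (5802368 lanes, depth 5, threshold 11; est 26 s): every selection with largest row there passes (lane engine, KERNEL). -/
theorem psegX_0_5 : Plane.segOK 192 11 (S8_4x24_w6_k12_0001111.cert.sideX.found.map Prod.fst) S8_4x24_w6_k12_0001111.pGX_0 5 82 3 51 = true := by
  decide +kernel

set_option maxHeartbeats 400000000 in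
/-- `X` view 0, lane segment `[85, 87)` (4356848 lanes, depth 5, threshold 11; est 16 s): every selection with largest row there passes (lane engine, KERNEL). -/
theorem psegX_0_6 : Plane.segOK 192 11 (S8_4x24_w6_k12_0001111.cert.sideX.found.map Prod.fst) S8_4x24_w6_k12_0001111.pGX_0 5 85 2 51 = true := by
  decide +kernel

set_option maxHeartbeats 400000000 in
/-- `X` view 0, lane segment `[87, 89)` (4781262 lanes, depth 5, threshold 11; est 21 s): every selection with largest row there passes (lane engine, KERNEL). -/
theorem psegX_0_7 : Plane.segOK 192 11 (S8_4x24_w6_k12_0001111.cert.sideX.found.map Prod.fst) S8_4x24_w6_k12_0001111.pGX_0 5 87 2 51 = true := by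
  decide +kernel

set_option maxHeartbeats 400000000 in
/-- `X` view 0, lane segment `[89, 91)` (5235962 lanes, depth 5, threshold 11; est 18 s): every selection with largest row there passes (lane engine, KERNEL). -/
theorem psegX_0_8 : Plane.segOK 192 11 (S8_4x24_w6_k12_0001111.cert.sideX.found.map Prod.fst) S8_4x24_w6_k12_0001111.pGX_0 5 89 2 51 = true := by
  decide +kernel

set_option maxHeartbeats 400000000 in
/-- `X` view 0, lane segment `[91, 93)` (5722356 lanes, depth 5, threshold 11; est 26 s): every selection with largest row there passes (lane engine, KERNEL). -/
theorem psegX_0_9 : Plane.segOK 192 11 (S8_4x24_w6_k12_0001111.cert.sideX.found.map Prod.fst) S8_4x24_w6_k12_0001111.pGX_0 5 91 2 51 = true := by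
  decide +kernel

set_option maxHeartbeats 400000000 in
/-- `X` view 0, lane segment `[93, 95)` (6241884 lanes, depth 5, threshold 11; est 28 s): every selection with largest row there passes (lane engine, KERNEL). -/
theorem psegX_0_10 : Plane.segOK 192 11 (S8_4x24_w6_k12_0001111.cert.sideX.found.map Prod.fst) S8_4x24_w6_k12_0001111.pGX_0 5 93 2 51 = true := by
  decide +kernel

end Summit.Ventures.QEC.Census.S8_4x24_w6_k12_0001111
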